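/-
Copyright (c) 2026 the pub-hodgecm-mathlib formalisation cell (harness21).  Prover seat hodgecm-mathlib-F0P3b-p01 (g25); E1 keeper ∕ dealer F0P3a-p03 (g29), E1 BRICK
LEDGER row 27 «COMPACT-PICTURE JET @ DATUM», input (β) «HEIGHT» (census `F0/P2/p02/g25/jet/CENSUS-JET-AT-DATUM.v1` 35cdd4c6 §(β)∕§5; keeper ruling 2026-09-03T01:14:52Z).
-/
import Mathlib.Algebra.Group.Subgroup.Basic
import Mathlib.Topology.Algebra.Group.Basic
import Mathlib.Topology.LocallyConstant.Basic
import HarnessLib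

/-!
# The additive height attached to a product decomposition `G = H · K` («Iwasawa height»)

Topic `GroupTheory`; namespace `Literature.GroupTheory`.  THEOREMS ONLY (no definition, no instance, no notation, no named fact, no `sorry`); Mathlib only.

WHAT (elementary; the abstract form of the Iwasawa height `g = b·κ ↦ log|a(b)|` of a `p`-adic group `G = B·K`,
[Casselman1995, §3.1], [BernsteinZelevinsky1977, §1.9 ∕ §2.3], [CartierCorvallis1979, §IV.1]).  Let `H, K ≤ G` be subgroups with `G = H·K`
(`hGK : ∀ g, ∃ h : H, ∃ κ ∈ K, g = h κ` — the shape of ★ `exists_borel_mul_mem_cmLocalIntegralLevel`), and let `λ : H → A` be ADDITIVE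
(`λ(h h') = λ h + λ h'`) into an additive commutative group `A` and TRIVIAL ON `H ∩ K`.  Then `Λ(h κ) := λ(h)` is well defined and is the unique
function `Λ : G → A` with
* `Λ (h * g) = λ h + Λ g` (left `H`-equivariance),  * `Λ (x * κ) = Λ x` for `κ ∈ K` (right `K`-invariance),  * `Λ κ = 0` on `K`.
If `G` is a topological group and `K` is OPEN, a right-`K`-invariant function is LOCALLY CONSTANT.
* §1 **`exists_height_of_mul_decomposition`** — existence with the three properties; `height_unique_of_mul_decomposition` — uniqueness.
* §2 **`isLocallyConstant_of_mul_invariant`** — right invariance under an open subgroup ⇒ locally constant.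
CONSUMER: ★ `Literature.NumberTheory.Automorphic.SmoothInductionUnipotentModelJet` (E1 row 27 J1, F0P2-p02 (g25)) takes exactly the letters
`(Λ, hΛ : Λ (h * g) = lam h + Λ g, KΛ, hKΛ : IsOpen KΛ, hΛK : Λ (x * κ) = Λ x)`; the CM datum instance is `Theorems/F0P3cStCharTSHeightAtDatum` (this seat).
HONEST LABEL: count-neutral group theory; cell `pub/hodgecm-mathlib`, crux H413 = `stmt-HodgeConjecture-24833` (`--supports` lane); HC_CM is proved only modulo the printed
citations of that programme until its rung 0 closes.

## References
* [Casselman1995] W. Casselman, *Introduction to the theory of admissible representations of p-adic reductive groups* (1995), §3.1.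
* [BernsteinZelevinsky1977] I. N. Bernstein, A. V. Zelevinsky, *Induced representations of reductive p-adic groups I*, Ann. Sci. ÉNS 10 (1977), §1.9, §2.3.
* [CartierCorvallis1979] P. Cartier, *Representations of p-adic groups: a survey*, Proc. Symp. Pure Math. 33 (1979), part 1, §IV.1.
-/

set_option autoImplicit false

namespace Literature.GroupTheory

/-! ## §1 The height of a decomposition `G = H · K` -/

section Height

variable {G : Type*} [Group G] {A : Type*} [AddCommGroup A] (H K : Subgroup G)

/-- **WELL-DEFINEDNESS**: if `h κ = h' κ'` with `κ, κ' ∈ K`, then `h'⁻¹ h = κ' κ⁻¹ ∈ H ∩ K`, so an additive `λ` trivial on `H ∩ K` takes the same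
value on `h` and `h'`. [cite: Casselman1995, §3.1] [cite: CartierCorvallis1979, §IV.1] -/
theorem height_aux_eq_of_mul_eq_mul (lam : H → A) (hmul : ∀ h h' : H, lam (h * h') = lam h + lam h')
    (hK : ∀ h : H, (h : G) ∈ K → lam h = 0) {h h' : H} {κ κ' : G} (hκ : κ ∈ K) (hκ' : κ' ∈ K)
    (he : (h : G) * κ = (h' : G) * κ') : lam h = lam h' := by
  -- `h'⁻¹ * h = κ' * κ⁻¹ ∈ K`
  have hmem : ((h'⁻¹ * h : H) : G) ∈ K := by
    have e1 : ((h'⁻¹ * h : H) : G) = κ' * κ⁻¹ := by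
      rw [Subgroup.coe_mul, Subgroup.coe_inv, inv_mul_eq_iff_eq_mul, ← mul_assoc, ← he, mul_assoc, mul_inv_cancel, mul_one]
    rw [e1]
    exact K.mul_mem hκ' (K.inv_mem hκ)
  have h0 := hK _ hmem
  -- additivity: `lam 1 = 0`, `lam h⁻¹ = - lam h`
  have h1 : lam 1 = 0 := by
    have h11 := hmul 1 1
    rw [mul_one] at h11
    exact add_left_cancel (h11.symm.trans (add_zero _).symm)
  have hinv : lam h'⁻¹ = -lam h' := by
    have := hmul h'⁻¹ h'
    rw [inv_mul_cancel, h1] at this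
    exact (neg_eq_of_add_eq_zero_left this.symm).symm
  rw [hmul, hinv] at h0
  exact (neg_add_eq_zero.mp h0).symm

/-- **THE HEIGHT OF A DECOMPOSITION `G = H · K`.**  For subgroups `H, K ≤ G` with `G = H·K` and an additive `λ : H → A` trivial on `H ∩ K`
there is `Λ : G → A` with `Λ (h g) = λ h + Λ g` (`h ∈ H`), `Λ (x κ) = Λ x` (`κ ∈ K`) and `Λ|_K = 0` — namely `Λ(h κ) := λ h`.
(The Iwasawa height `H(b k) = log|a(b)|` of `G = B·K` is the case `λ = log|a|`.) [cite: Casselman1995, §3.1] [cite: BernsteinZelevinsky1977, §2.3]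
[cite: CartierCorvallis1979, §IV.1] -/
theorem exists_height_of_mul_decomposition (hGK : ∀ g : G, ∃ h : H, ∃ κ : G, κ ∈ K ∧ g = (h : G) * κ)
    (lam : H → A) (hmul : ∀ h h' : H, lam (h * h') = lam h + lam h') (hK : ∀ h : H, (h : G) ∈ K → lam h = 0) :
    ∃ Λ : G → A, (∀ (h : H) (g : G), Λ ((h : G) * g) = lam h + Λ g) ∧ (∀ (x κ : G), κ ∈ K → Λ (x * κ) = Λ x) ∧
      ∀ κ : G, κ ∈ K → Λ κ = 0 := by
  classical
  choose hh κκ hκκ hdec using hGK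
  -- `Λ g := lam (hh g)`; the key: any other decomposition gives the same value
  have hwd : ∀ (g : G) (h : H) (κ : G), κ ∈ K → g = (h : G) * κ → lam (hh g) = lam h := fun g h κ hκ hg =>
    height_aux_eq_of_mul_eq_mul H K lam hmul hK (hκκ g) hκ ((hdec g).symm.trans hg)
  refine ⟨fun g => lam (hh g), fun h g => ?_, fun x κ hκ => ?_, fun κ hκ => ?_⟩
  · -- `h * g = (h * hh g) * κκ g`
    show lam (hh ((h : G) * g)) = lam h + lam (hh g)
    rw [hwd ((h : G) * g) (h * hh g) (κκ g) (hκκ g) (by rw [Subgroup.coe_mul, mul_assoc, ← hdec g]), hmul]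
  · -- `x * κ = hh x * (κκ x * κ)`
    show lam (hh (x * κ)) = lam (hh x)
    exact hwd (x * κ) (hh x) (κκ x * κ) (K.mul_mem (hκκ x) hκ) (by rw [← mul_assoc, ← hdec x])
  · -- `κ = 1 * κ`
    show lam (hh κ) = 0
    rw [hwd κ 1 κ hκ (by rw [Subgroup.coe_one, one_mul])]
    have h11 := hmul 1 1
    rw [mul_one] at h11
    exact add_left_cancel (h11.symm.trans (add_zero _).symm)

/-- **UNIQUENESS**: a function with `Λ (h g) = λ h + Λ g` and `Λ|_K = 0` is determined on `G = H·K` (`Λ (h κ) = λ h`).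
[cite: Casselman1995, §3.1] [cite: CartierCorvallis1979, §IV.1] -/
theorem height_unique_of_mul_decomposition (hGK : ∀ g : G, ∃ h : H, ∃ κ : G, κ ∈ K ∧ g = (h : G) * κ)
    (lam : H → A) {Λ Λ' : G → A} (hΛ : ∀ (h : H) (g : G), Λ ((h : G) * g) = lam h + Λ g) (hΛK : ∀ κ : G, κ ∈ K → Λ κ = 0)
    (hΛ' : ∀ (h : H) (g : G), Λ' ((h : G) * g) = lam h + Λ' g) (hΛ'K : ∀ κ : G, κ ∈ K → Λ' κ = 0) : Λ = Λ' := by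
  funext g
  obtain ⟨h, κ, hκ, rfl⟩ := hGK g
  rw [hΛ, hΛ', hΛK κ hκ, hΛ'K κ hκ]

/-- The value on a decomposed element: `Λ (h κ) = λ h`. [cite: Casselman1995, §3.1] -/
theorem height_apply_mul_of_mem {lam : H → A} {Λ : G → A} (hΛ : ∀ (h : H) (g : G), Λ ((h : G) * g) = lam h + Λ g)
    (hΛK : ∀ κ : G, κ ∈ K → Λ κ = 0) (h : H) {κ : G} (hκ : κ ∈ K) : Λ ((h : G) * κ) = lam h := by
  rw [hΛ, hΛK κ hκ, add_zero]

end Height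

/-! ## §2 Right invariance under an open subgroup ⇒ locally constant -/

section LocallyConstant

variable {G : Type*} [Group G] [TopologicalSpace G] [ContinuousMul G] {A : Type*}

/-- **A right-`K`-invariant function is locally constant when `K` is open**: it is constant on every coset `x·K`, an open neighbourhood of `x`
(left translation is a homeomorphism).  This is the «smoothness» of the Iwasawa height. [cite: Casselman1995, §3.1] [cite: BernsteinZelevinsky1977, §1.9] -/
theorem isLocallyConstant_of_mul_invariant {K : Subgroup G} (hKo : IsOpen (K : Set G)) {Λ : G → A}
    (hΛ : ∀ (x κ : G), κ ∈ K → Λ (x * κ) = Λ x) : IsLocallyConstant Λ := by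
  refine (IsLocallyConstant.iff_exists_open Λ).2 fun x => ⟨(fun κ => x * κ) '' (K : Set G), ?_, ?_, ?_⟩
  · exact (Homeomorph.mulLeft x).isOpenMap _ hKo
  · exact ⟨1, K.one_mem, mul_one x⟩
  · rintro y ⟨κ, hκ, rfl⟩
    exact hΛ x κ hκ

/-- Packaged form for the consumer ★ `SmoothInductionUnipotentModelJet`: from `G = H·K`, `K` open, `λ` additive and trivial on `H ∩ K`, a height with the
J1 letters `(hΛ, hΛK)` AND local constancy AND `Λ|_K = 0`. [cite: Casselman1995, §3.1] [cite: BernsteinZelevinsky1977, §2.3] [cite: CartierCorvallis1979, §IV.1] -/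
theorem exists_height_of_mul_decomposition_of_isOpen (H K : Subgroup G) (hKo : IsOpen (K : Set G))
    (hGK : ∀ g : G, ∃ h : H, ∃ κ : G, κ ∈ K ∧ g = (h : G) * κ) {A : Type*} [AddCommGroup A]
    (lam : H → A) (hmul : ∀ h h' : H, lam (h * h') = lam h + lam h') (hK : ∀ h : H, (h : G) ∈ K → lam h = 0) :
    ∃ Λ : G → A, (∀ (h : H) (g : G), Λ ((h : G) * g) = lam h + Λ g) ∧ (∀ (x κ : G), κ ∈ K → Λ (x * κ) = Λ x) ∧
      (∀ κ : G, κ ∈ K → Λ κ = 0) ∧ IsLocallyConstant Λ := by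
  obtain ⟨Λ, h1, h2, h3⟩ := exists_height_of_mul_decomposition H K hGK lam hmul hK
  exact ⟨Λ, h1, h2, h3, isLocallyConstant_of_mul_invariant hKo h2⟩

end LocallyConstant

end Literature.GroupTheory
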